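import Summits.Ventures.HodgeRepro2.T5FinitePlaceLiesOver
import Mathlib.NumberTheory.RamificationInertia.Galois

/-!
# `e = f = 1 ⟹ L_w = Kᵥ`: a place with trivial ramification and trivial residue extension has trivial local degree
(cell pub-hodge-repro2, seat p3)

Tier-5 N2 support, §N2.9.2 of route/T5-N2-route-3.md («completions») at the finite places — the missing direction
of the global count, by the classical successive-approximation argument, in kernel: for number fields `K ⊆ L` and
`w ∣ v` with `e(w∣v) = 1` and `f(w∣v) = 1`,
* the residue map `𝓞_K/v → 𝓞_L/w` is onto (`exists_sub_mul_mem_of_inertiaDeg_eq_one`, from `f = 1`);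
* hence every `w`-integral `z ∈ L_w` is congruent mod `w` to an element of `𝓞_K`
  (`exists_valued_sub_le_exp_neg_one`, by the density of `L` in `L_w`);
* a uniformiser `π` of `v` is a uniformiser of `L_w` (`valued_algebraMap_uniformizer`, from `e = 1`);
* successive approximation: every `w`-integral `z` is within `exp (−n)` of `Kᵥ` for every `n`
  (`exists_valued_sub_le_exp_neg`), so `Kᵥ` is dense in `L_w` (`denseRange_completionMap`);
* the image of `Kᵥ` is a finite-dimensional subspace, hence closed: **`completionMap` is surjective**
  (`completionMap_surjective`) and **`[L_w : Kᵥ] = 1`** (`finrank_eq_one_of_ramificationIdx_eq_one_of_inertiaDeg_eq_one`).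
Mathlib + file 115 only. No display; no device. §8(d): uses an L-value-free non-vanishing device: NO.
-/

namespace Summit.Ventures.HodgeRepro2.T5FinitePlaceUnramifiedResidue

open IsDedekindDomain IsDedekindDomain.HeightOneSpectrum NumberField Module WithZero Topology
open scoped Summit.Ventures.HodgeRepro2.T5FinitePlaceLiesOver Valued
open Summit.Ventures.HodgeRepro2.T5FinitePlaceLiesOver

section WithZeroLemmas

/-- `a < 1 → a ≤ exp (−1)` in `ℤᵐ⁰`. -/
theorem le_exp_neg_one_of_lt_one {a : ℤᵐ⁰} (ha : a < 1) : a ≤ exp (-1 : ℤ) := by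
  rcases eq_or_ne a 0 with rfl | h0
  · exact zero_le
  · rw [← exp_log h0] at ha ⊢
    rw [← exp_zero, exp_lt_exp] at ha
    rw [exp_le_exp]
    omega

end WithZeroLemmas

variable {K L : Type*} [Field K] [NumberField K] [Field L] [NumberField L] [Algebra K L]
variable (v : HeightOneSpectrum (𝓞 K)) (w : HeightOneSpectrum (𝓞 L)) [w.asIdeal.LiesOver v.asIdeal]

section Residue

include v in
/-- **The residue map is onto when `f(w∣v) = 1`:** for `a, b ∈ 𝓞_L` with `b ∉ w` there is `c ∈ 𝓞_K` with
`a ≡ c · b (mod w)`. -/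
theorem exists_sub_mul_mem_of_inertiaDeg_eq_one (hf : w.asIdeal.inertiaDeg (𝓞 K) = 1) (a : 𝓞 L) {b : 𝓞 L}
    (hb : b ∉ w.asIdeal) : ∃ c : 𝓞 K, a - algebraMap (𝓞 K) (𝓞 L) c * b ∈ w.asIdeal := by
  haveI : v.asIdeal.IsMaximal := v.isMaximal
  haveI : w.asIdeal.IsMaximal := w.isMaximal
  letI : Field (𝓞 K ⧸ v.asIdeal) := Ideal.Quotient.field _
  letI : Field (𝓞 L ⧸ w.asIdeal) := Ideal.Quotient.field _
  have h1 : finrank (𝓞 K ⧸ v.asIdeal) (𝓞 L ⧸ w.asIdeal) = 1 := by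
    rw [← Ideal.inertiaDeg'_algebraMap, Ideal.inertiaDeg'_eq_inertiaDeg, hf]
  obtain ⟨-, hsurj⟩ := Algebra.finrank_eq_one_iff_bijective_algebraMap.mp h1
  have hb0 : Ideal.Quotient.mk w.asIdeal b ≠ 0 := fun h => hb (Ideal.Quotient.eq_zero_iff_mem.mp h)
  obtain ⟨c', hc'⟩ := hsurj (Ideal.Quotient.mk w.asIdeal a * (Ideal.Quotient.mk w.asIdeal b)⁻¹)
  obtain ⟨c, rfl⟩ := Ideal.Quotient.mk_surjective c'
  refine ⟨c, ?_⟩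
  rw [← Ideal.Quotient.eq_zero_iff_mem, map_sub, map_mul]
  have h2 : Ideal.Quotient.mk w.asIdeal (algebraMap (𝓞 K) (𝓞 L) c) =
      Ideal.Quotient.mk w.asIdeal a * (Ideal.Quotient.mk w.asIdeal b)⁻¹ := hc'
  rw [h2, inv_mul_cancel_right₀ hb0, sub_self]

/-- `Kᵥ → L_w` on `𝓞_K`: `algebraMap (𝓞 K) L_w c = completionMap (algebraMap (𝓞 K) Kᵥ c)`. -/
theorem algebraMap_eq_completionMap_algebraMap (c : 𝓞 K) :
    algebraMap (𝓞 K) (w.adicCompletion L) c =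
      completionMap K L v w (algebraMap (𝓞 K) (v.adicCompletion K) c) := by
  rw [IsScalarTower.algebraMap_apply (𝓞 K) K (w.adicCompletion L),
    IsScalarTower.algebraMap_apply (𝓞 K) K (v.adicCompletion K),
    IsScalarTower.algebraMap_apply K (v.adicCompletion K) (w.adicCompletion L), algebraMap_eq_completionMap]

include v in
/-- **Every `w`-integral element of `L_w` is congruent mod `w` to an element of `𝓞_K`** when `f(w∣v) = 1`. -/
theorem exists_valued_sub_le_exp_neg_one (hf : w.asIdeal.inertiaDeg (𝓞 K) = 1) (z : w.adicCompletion L)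
    (hz : Valued.v z ≤ 1) :
    ∃ c : 𝓞 K, Valued.v (z - algebraMap (𝓞 K) (w.adicCompletion L) c) ≤ exp (-1 : ℤ) := by
  -- density of `L` in `L_w`
  have hd : DenseRange (algebraMap L (w.adicCompletion L)) := denseRange_algebraMap (K := L) (v := w)
  have hU : {y : w.adicCompletion L | Valued.v (y - z) < 1} ∈ 𝓝 z := by
    rw [Valued.mem_nhds]
    refine ⟨1, fun y hy => ?_⟩
    simpa [Valuation.restrict_lt_iff_lt_embedding] using hy
  obtain ⟨x, hx⟩ := hd.mem_nhds hU
  simp only [Set.mem_setOf_eq] at hx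
  -- `x` is `w`-integral
  have hx1 : Valued.v (algebraMap L (w.adicCompletion L) x) ≤ 1 := by
    have : algebraMap L (w.adicCompletion L) x = z - (z - algebraMap L (w.adicCompletion L) x) := by ring
    rw [this]
    exact (Valuation.map_sub _ _ _).trans (max_le hz (by rw [← neg_sub, Valuation.map_neg]; exact hx.le))
  have hx1' : w.valuation L x ≤ 1 := by
    rw [show algebraMap L (w.adicCompletion L) x = (x : w.adicCompletion L) from rfl,
      adicCompletion.valued_coe] at hx1
    exact hx1
  obtain ⟨n, d, hnd⟩ := exists_primeCompl_mul_eq_of_integer w x hx1'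
  obtain ⟨c, hc⟩ := exists_sub_mul_mem_of_inertiaDeg_eq_one v w hf n d.prop
  refine ⟨c, ?_⟩
  have hd0 : (d : 𝓞 L) ≠ 0 := fun h => d.prop (by rw [h]; exact zero_mem _)
  have hdL : algebraMap (𝓞 L) L d ≠ 0 := by simpa using hd0
  have hxc : x - algebraMap (𝓞 K) L c =
      algebraMap (𝓞 L) L (n - algebraMap (𝓞 K) (𝓞 L) c * d) / algebraMap (𝓞 L) L d := by
    rw [map_sub, map_mul, eq_div_iff hdL, sub_mul, ← hnd, IsScalarTower.algebraMap_apply (𝓞 K) (𝓞 L) L]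
  have hval : w.valuation L (x - algebraMap (𝓞 K) L c) ≤ exp (-1 : ℤ) := by
    rw [hxc, map_div₀, valuation_of_algebraMap, valuation_of_algebraMap,
      (w.intValuation_eq_one_iff_mem_primeCompl d).mpr d.prop, div_one]
    have := (w.intValuation_le_pow_iff_mem _ 1).mpr (by rw [pow_one]; exact hc)
    simpa using this
  have h1 : z - algebraMap (𝓞 K) (w.adicCompletion L) c =
      (z - algebraMap L (w.adicCompletion L) x) +
        algebraMap L (w.adicCompletion L) (x - algebraMap (𝓞 K) L c) := by
    rw [map_sub, IsScalarTower.algebraMap_apply (𝓞 K) K (w.adicCompletion L),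
      IsScalarTower.algebraMap_apply K L (w.adicCompletion L), ← IsScalarTower.algebraMap_apply (𝓞 K) K L]
    ring
  rw [h1]
  refine (Valuation.map_add _ _ _).trans (max_le ?_ ?_)
  · rw [← neg_sub, Valuation.map_neg]
    exact le_exp_neg_one_of_lt_one hx
  · rw [show algebraMap L (w.adicCompletion L) (x - algebraMap (𝓞 K) L c) =
        ((x - algebraMap (𝓞 K) L c : L) : w.adicCompletion L) from rfl, adicCompletion.valued_coe]
    exact hval

end Residue

section Uniformizer

include v in
/-- **A uniformiser of `v` is a uniformiser of `L_w`** when `e(w∣v) = 1`. -/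
theorem exists_valued_algebraMap_eq_exp_neg_one (he : w.asIdeal.ramificationIdx (𝓞 K) = 1) :
    ∃ π : 𝓞 K, Valued.v (algebraMap (𝓞 K) (w.adicCompletion L) π) = exp (-1 : ℤ) := by
  obtain ⟨π, hπ⟩ := intValuation_exists_uniformizer v
  refine ⟨π, ?_⟩
  rw [algebraMap_eq_completionMap_algebraMap v w, valued_completionMap,
    Ideal.ramificationIdx'_eq_ramificationIdx v.asIdeal w.asIdeal v.ne_bot, he, pow_one,
    IsScalarTower.algebraMap_apply (𝓞 K) K (v.adicCompletion K),
    show algebraMap K (v.adicCompletion K) (algebraMap (𝓞 K) K π) =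
      ((algebraMap (𝓞 K) K π : K) : v.adicCompletion K) from rfl,
    adicCompletion.valued_coe, valuation_of_algebraMap, hπ]

end Uniformizer

section Approximation

/-- **Successive approximation:** if `f(w∣v) = 1` and `Π ∈ Kᵥ` is a uniformiser of `L_w`, every `w`-integral
`z ∈ L_w` is within `exp (−n)` of `Kᵥ`, for every `n`. -/
theorem exists_valued_sub_le_exp_neg (hf : w.asIdeal.inertiaDeg (𝓞 K) = 1) {p : v.adicCompletion K}
    (hp : Valued.v (completionMap K L v w p) = exp (-1 : ℤ)) (n : ℕ) :
    ∀ z : w.adicCompletion L, Valued.v z ≤ 1 →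
      ∃ a : v.adicCompletion K, Valued.v (z - completionMap K L v w a) ≤ exp (-(n : ℤ)) := by
  have hP0 : completionMap K L v w p ≠ 0 := by
    intro h
    rw [h, map_zero] at hp
    exact (exp_pos (a := (-1 : ℤ))).ne hp
  induction n with
  | zero =>
    intro z hz
    refine ⟨0, ?_⟩
    rw [map_zero, sub_zero, Nat.cast_zero, neg_zero, exp_zero]
    exact hz
  | succ n ih =>
    intro z hz
    obtain ⟨c, hc⟩ := exists_valued_sub_le_exp_neg_one v w hf z hz
    set z₁ := (z - algebraMap (𝓞 K) (w.adicCompletion L) c) / completionMap K L v w p with hz₁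
    have hz₁int : Valued.v z₁ ≤ 1 := by
      rw [hz₁, map_div₀, hp, div_le_one₀ exp_pos]
      exact hc
    obtain ⟨b, hb⟩ := ih z₁ hz₁int
    refine ⟨algebraMap (𝓞 K) (v.adicCompletion K) c + p * b, ?_⟩
    have h1 : z - completionMap K L v w (algebraMap (𝓞 K) (v.adicCompletion K) c + p * b) =
        completionMap K L v w p * (z₁ - completionMap K L v w b) := by
      rw [map_add, map_mul, ← algebraMap_eq_completionMap_algebraMap v w, hz₁, mul_sub,
        mul_div_cancel₀ _ hP0]
      ring
    rw [h1, map_mul, hp]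
    calc exp (-1 : ℤ) * Valued.v (z₁ - completionMap K L v w b)
        ≤ exp (-1 : ℤ) * exp (-(n : ℤ)) := mul_le_mul_right hb _
      _ = exp (-((n + 1 : ℕ) : ℤ)) := by
        rw [← exp_add]
        congr 1
        push_cast
        ring

end Approximation

section Closure

/-- The image of `Kᵥ` in `L_w`, as a `Kᵥ`-submodule. -/
noncomputable def rangeSubmodule : Submodule (v.adicCompletion K) (w.adicCompletion L) :=
  LinearMap.range (Algebra.linearMap (v.adicCompletion K) (w.adicCompletion L))

/-- `z ∈ rangeSubmodule ↔ ∃ a, completionMap a = z`. -/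
theorem mem_rangeSubmodule_iff (z : w.adicCompletion L) :
    z ∈ rangeSubmodule v w ↔ ∃ a : v.adicCompletion K, completionMap K L v w a = z :=
  Iff.rfl

/-- The image of `Kᵥ` is closed in `L_w` (a finite-dimensional subspace over the complete field `Kᵥ`). -/
theorem isClosed_rangeSubmodule : IsClosed ((rangeSubmodule v w : Submodule _ _) : Set (w.adicCompletion L)) :=
  Submodule.closed_of_finiteDimensional (𝕜 := v.adicCompletion K) (rangeSubmodule v w)

/-- A `w`-integral element of `L_w` lies in the (closed) image of `Kᵥ` when `e = f = 1`. -/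
theorem mem_rangeSubmodule_of_valued_le_one (hf : w.asIdeal.inertiaDeg (𝓞 K) = 1) {p : v.adicCompletion K}
    (hp : Valued.v (completionMap K L v w p) = exp (-1 : ℤ)) (z : w.adicCompletion L) (hz : Valued.v z ≤ 1) :
    z ∈ rangeSubmodule v w := by
  have hcl := isClosed_rangeSubmodule v w
  rw [← SetLike.mem_coe, ← hcl.closure_eq, mem_closure_iff_nhds]
  intro U hU
  obtain ⟨γ, hγ⟩ := Valued.mem_nhds.mp hU
  have h0 : Valued.v (z - z) < _ :=
    (Valuation.restrict_lt_iff_lt_embedding (v := (Valued.v : Valuation (w.adicCompletion L) ℤᵐ⁰))).mp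
      (by rw [sub_self, map_zero]; exact Units.zero_lt γ)
  rw [sub_self, map_zero] at h0
  obtain ⟨n, hn⟩ := exists_exp_neg_natCast_lt h0.ne'
  obtain ⟨a, ha⟩ := exists_valued_sub_le_exp_neg v w hf hp n z hz
  refine ⟨completionMap K L v w a, hγ ?_, ⟨a, rfl⟩⟩
  show Valued.v.restrict (completionMap K L v w a - z) < (γ : _)
  rw [Valuation.restrict_lt_iff_lt_embedding, ← neg_sub, Valuation.map_neg]
  exact lt_of_le_of_lt ha hn

/-- **`Kᵥ` is all of `L_w` when `e = f = 1`:** `completionMap` is surjective. -/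
theorem completionMap_surjective (he : w.asIdeal.ramificationIdx (𝓞 K) = 1)
    (hf : w.asIdeal.inertiaDeg (𝓞 K) = 1) : Function.Surjective (completionMap K L v w) := by
  obtain ⟨π, hπ⟩ := exists_valued_algebraMap_eq_exp_neg_one v w he
  rw [algebraMap_eq_completionMap_algebraMap v w] at hπ
  set p := algebraMap (𝓞 K) (v.adicCompletion K) π with hpdef
  have hp0 : p ≠ 0 := by
    intro h
    rw [h, map_zero, map_zero] at hπ
    exact (exp_pos (a := (-1 : ℤ))).ne hπ
  intro z
  rcases eq_or_ne z 0 with rfl | hz0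
  · exact ⟨0, map_zero _⟩
  have hvz : Valued.v z ≠ 0 := (Valuation.ne_zero_iff _).mpr hz0
  -- clear the denominator with a power of `p`
  set m : ℕ := (log (Valued.v z)).toNat with hm
  have hint : Valued.v (completionMap K L v w (p ^ m) * z) ≤ 1 := by
    rw [map_mul, map_pow, map_pow, hπ, ← exp_nsmul, nsmul_eq_mul, mul_neg_one, ← exp_log hvz, ← exp_add]
    rw [← exp_zero, exp_le_exp]
    have := Int.self_le_toNat (log (Valued.v z))
    omega
  have hmem := mem_rangeSubmodule_of_valued_le_one v w hf hπ _ hint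
  obtain ⟨a, ha⟩ := (mem_rangeSubmodule_iff v w _).mp hmem
  refine ⟨(p ^ m)⁻¹ * a, ?_⟩
  rw [map_mul, ha, map_inv₀, map_pow, ← mul_assoc, inv_mul_cancel₀ (pow_ne_zero _ ((map_ne_zero _).mpr hp0)),
    one_mul]

/-- **`[L_w : Kᵥ] = 1` when `e(w∣v) = f(w∣v) = 1`.** -/
theorem finrank_eq_one_of_ramificationIdx_eq_one_of_inertiaDeg_eq_one
    (he : w.asIdeal.ramificationIdx (𝓞 K) = 1) (hf : w.asIdeal.inertiaDeg (𝓞 K) = 1) :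
    finrank (v.adicCompletion K) (w.adicCompletion L) = 1 :=
  Algebra.finrank_eq_one_iff_bijective_algebraMap.mpr
    ⟨(algebraMap (v.adicCompletion K) (w.adicCompletion L)).injective, completionMap_surjective v w he hf⟩

end Closure

end Summit.Ventures.HodgeRepro2.T5FinitePlaceUnramifiedResidue
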